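import Summits.HodgeConjecture.HodgeConjecture.Theorems.R90S3QuadraticCharUnramifiedOff   -- F2 (this seat): `key_of_complexConj_eq` (+ ★ p863377, T1, TorusLocalDatum)
import Summits.HodgeConjecture.HodgeConjecture.Theorems.R90S3AuxGlobaliseCharKeyCyclic     -- F1 (this seat): `exists_update_prod_zpow_mul_eq_one`
import Summits.HodgeConjecture.HodgeConjecture.Theorems.R90S3InfCharFamily                 -- ★ p863523 (B2, R90-C14-p01): `infCharFamily_continuous ∕ _norm_eq_one ∕ _odd ∕ _shift`
import HarnessLib

/-!
# R90-TF · S3 · THEOREMS — `R90S3AuxGlobaliseCharKey` ((U3-χ) brick B1, file F3 of 3): THE KEY OF WEIL'S EXTENSION PRINCIPLE for the character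
# globalisation socket — `exists_odd_key_of_infCharFamily` and the assembly `exists_infChar_key_of_family` (probe heads VERBATIM), plus the instantiated
# key `exists_infChar_key` at the family `Φ_n = circleToUnits ∘ infinityTypeChar L′ n` (★ B2)

R90-TF section S3 (successor dealer R90-C12-plan (g2), RULING S3-R24 2026-09-05T00:07:10Z «(B1) → K2E3-p21»; interface of record = K2E3-p17 (g10)'s probe
`R90/S3/K2E3-p17-g10/B1B2Interface.HOMEONLY.lean` d711d29af2f0f708; dealer 00:19:12Z: instantiate with ★ p863523); crux H413 (`stmt-HodgeConjecture-24833`,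
lane `--supports … --as helper`), route `HCCMUnconditional`.  PAYS the `hKey` binder of ★ p863377 `auxGlobaliseChar_of_key` = the (U3-χ) socket
`stub_R90_S3_auxGlobaliseChar` of `Cruxes/H413/Lines/R90_S3_LocalTransportWaveG.lean` :669 (plug of record, G ED. n, S3 pen:
`stub_R90_S3_auxGlobaliseChar L v L' v' Φ hc hc' hΦσ hur' hv' μ hμu hμω := by obtain ⟨Φ∞, h1, h2, hK⟩ := exists_infChar_key L v L' v' Φ hc hc' hΦσ hur' hv' μ hμu hμω;
exact auxGlobaliseChar_of_key L v L' v' Φ hc' hv' μ hμu Φ∞ h1 h2 hK`).  THEOREMS ONLY (no `def`, no `instance`, no notation, no named fact, no `sorry`);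
★ imports only; never imports `Cruxes/…/Lines`.

THE MATHEMATICS [Rogawski1990 §13.8 p. 216 («`E¹ ∩ ∏_v 𝒪¹_v = μ(E)` … the infinite components absorb the roots of unity»); Weil1956 §1; Arthur2011Draft
d-p.310 (constancy on `Ż_{∞,u}`)].  Data: CM fields `L, L′`, places `v, v′` (`v′` NON-SPLIT: one place `w′ ∣ v′`, `hv′`), the (U3-F) ring datum `Φ` (`hΦσ`),
`L′∕L′⁺` unramified off `v′` (`hur′`), `μ` a Hecke character of `L` with `μ|_{𝕀_{L⁺}} = ω` (`hμω`); the transported local datum `χ := μ_v ∘ Φ⁻¹` is of `ω′`-type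
(★ T1).  A family `Φ_n` of archimedean characters with `Φ_n ∘ BC_∞ = ω′_∞` for odd `n` (`hodd`) and `Φ_{n+2j}(k_∞) = Φ_n(k_∞) · ∏_w ι_w(k∕k̄)^{j_w}` (`hshift`).
CLAIM: for some odd `n`, `Ψ_n(a, y, k) := ω′(a) · Φ_n(y_∞) · χ(blk_{w′} y) = 1` on every admissible triple `a_{L′} · y = (k)`, `y ∈ 𝕌^{(w′)}`.
PROOF.  (1) The triples form a GROUP `G ≤ 𝕀_{L′⁺} × 𝕀_{L′} × L′ˣ` and `ζ(a, y, k) := k ∕ k̄` is a homomorphism `G → L′ˣ` with values in `μ(L′)` (the idèle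
`(k∕k̄) = y∕ȳ` is a unit at every place moved by `c` — ★ `exists_pow_eq_one_of_mem_torus_of_forall_smul_ne`, the fixed `w′` being the harmless exception — so
`ζ^N = 1`, `N = #μ(L′)`): `pow_torsionOrder_eq_one_of_triple_unitIdelesAway`.  (2) `Ψ_n` is a character of `G`; by F2 `key_of_complexConj_eq` it KILLS `ker ζ`
(`k̄ = k`) for every odd `n`.  (3) F1 `exists_update_prod_zpow_mul_eq_one`: `Ψ_{n₀} = ι_{w₀}(ζ)^s` on `G`, i.e. `(∏_w ι_w(ζ)^{j_w}) · Ψ_{n₀} = 1` for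
`j := −s·δ_{w₀}`.  (4) `hshift` + `hodd`: `Φ_{n₀+2j}(y_∞) = Φ_{n₀}(y_∞) · ∏_w ι_w(ζ)^{j_w}` on triples (`y_∞ = k_∞ ∕ (a_{L′})_∞`), so `Ψ_{n₀+2j} ≡ 1` and `n₀ + 2j`
is odd.  No S-unit theorem and no parity hypothesis are needed (the correction is relative to `Ψ_{n₀}`; parity is encoded in `hodd`).
* §1 `pow_torsionOrder_eq_one_of_triple_unitIdelesAway` — finite order of `k∕k̄` on triples at a `c`-fixed place.
* §2 **`exists_odd_key_of_infCharFamily`** (probe head VERBATIM) · **`exists_infChar_key_of_family`** (probe assembly VERBATIM).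
* §3 **`exists_infChar_key`** — instantiated at `Φ_n := circleToUnits ∘ infinityTypeChar L′ n` with ★ B2's four lemmas (dealer 00:19:12Z); its
  conclusion is the `∃ Φ∞, Continuous ∧ unitary ∧ hKey` input of ★ `auxGlobaliseChar_of_key`; `example` = the plug shape (socket conclusion).

HONEST LABEL: HC_CM is proved only modulo the 7 printed citations (2 remaining named inputs: hLiu418 = stmt-HodgeConjecture-24832, h413 =
stmt-HodgeConjecture-24833) until rung 0 closes; (U3-χ) is paid only when G ED. n plugs `exists_infChar_key` + ★ `auxGlobaliseChar_of_key` into the socket;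
(U3-F) remains the declared residual; proves the KEY, nothing printed by itself; count-neutral.

## References
* [Rogawski1990] J. D. Rogawski, *Automorphic Representations of Unitary Groups in Three Variables*, Ann. of Math. Stud. 123 (1990), §13.8 pp. 212–216.
* [Weil1956] A. Weil, *On a certain type of characters of the idèle-class group of an algebraic number-field* (1956), §1.
* [Arthur2011Draft] J. Arthur, *The Endoscopic Classification of Representations* (2011 draft), d-p.309 Lemma 6.2.2, d-p.310.
-/

set_option autoImplicit false
-- the mandated namespace repeats the single-problem summit's segment (`HodgeConjecture.HodgeConjecture`)
set_option linter.dupNamespace false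

noncomputable section

namespace Summit.HodgeConjecture.HodgeConjecture.R90.S3

open NumberField IsDedekindDomain
open Literature.NumberTheory.GaloisRepresentations Literature.NumberTheory.GaloisRepresentations.HeckeCharacter
open Literature.NumberTheory.GaloisRepresentations.HeckeCharacter.CMQuadraticExtension
open Literature.NumberTheory.Automorphic IdeleHerbrand Literature.NumberTheory.Automorphic.UnitaryGroup
open Literature.NumberTheory.Automorphic.Arthur2013.Leaves.TECR
open Literature.NumberTheory.Automorphic.Arthur2013.Leaves.TECR.TorusDict
open Literature.NumberTheory.Rogawski1990

variable (L : Type) [Field L] [NumberField L] [IsCMField L] (v : HeightOneSpectrum (𝓞 ↥(maximalRealSubfield L)))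
  (L' : Type) [Field L'] [NumberField L'] [IsCMField L'] (v' : HeightOneSpectrum (𝓞 ↥(maximalRealSubfield L')))

/-! ## §1 `k ∕ k̄` has finite order on admissible triples at a `c`-fixed place -/

omit [IsCMField L] in
/-- **`(k∕k̄)^{#μ(L′)} = 1` on admissible triples.**  If `a_{L′} · y = (k)` with `a ∈ 𝕀_{L′⁺}`, `y ∈ 𝕌_{L′}^{(w′)}` and `w′` FIXED by complex conjugation, then
`k ∕ k̄` is a root of unity: the idèle `(k∕k̄) = y ∕ ȳ` is a global torus element and a unit at every place MOVED by `c` (`w′` is fixed), hence of finite order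
(★ `exists_pow_eq_one_of_mem_torus_of_forall_smul_ne`, Kronecker), hence killed by `#μ(L′) = Units.torsionOrder L′` (integral of finite order ⇒ in Mathlib's
`Units.torsion`).  (★ `archChar_mul_localDatum_eq_one_of_triple`'s finite-order block, CM spelling.) [cite: Arthur2011Draft, d-p.310] [cite: Weil1956, §1] -/
theorem pow_torsionOrder_eq_one_of_triple_unitIdelesAway (w' : UnitaryGroup.PlacesOver L' v') (hw' : IsCMField.complexConj L' • w'.1 = w'.1)
    {a : ideleGroup ↥(maximalRealSubfield L')} {y : ideleGroup L'} {k : L'ˣ} (hy : y ∈ unitIdelesAway w'.1)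
    (h : AdeleRing.ideleBaseChange ↥(maximalRealSubfield L') L' a * y = Literature.NumberTheory.GaloisRepresentations.principalIdele L' k) :
    (k * (Units.map (IsCMField.complexConj L' : L' →+* L').toMonoidHom k)⁻¹) ^ Units.torsionOrder L' = 1 := by
  classical
  haveI : Algebra.IsQuadraticExtension ↥(maximalRealSubfield L') L' := IsCMField.isQuadraticExtension L'
  set c := IsCMField.complexConj L' with hcdef
  have h2 : Module.finrank ↥(maximalRealSubfield L') L' = 2 := Algebra.IsQuadraticExtension.finrank_eq_two _ L'
  have hc : c ≠ 1 := IsCMField.complexConj_ne_one L'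
  have hTR : IsTotallyReal ↥(maximalRealSubfield L') := inferInstance
  have hTC : IsTotallyComplex L' := inferInstance
  set k' : L'ˣ := Units.map (c : L' →+* L').toMonoidHom k with hk'
  -- the quotient idèle `(k / c k) = y / (c • y)` is a global torus element, a unit at the places moved by `c`
  have hcy : AdeleRing.ideleBaseChange ↥(maximalRealSubfield L') L' a * (c • y) =
      Literature.NumberTheory.GaloisRepresentations.principalIdele L' k' := by
    rw [hk', ← smul_principalIdele, ← h, smul_mul', AdeleRing.smul_ideleBaseChange]
  have hquot : Literature.NumberTheory.GaloisRepresentations.principalIdele L' (k * k'⁻¹) = y * (c • y)⁻¹ := by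
    rw [map_mul, map_inv, ← h, ← hcy, ← div_eq_mul_inv, mul_div_mul_left_eq_div, div_eq_mul_inv]
  have htorus : Literature.NumberTheory.GaloisRepresentations.principalIdele L' (k * k'⁻¹) ∈ torus c := by
    rw [mem_torus_iff, hquot, smul_mul', smul_inv', smul_smul_self c h2 hc]
    group
  have hunit : ∀ w : HeightOneSpectrum (𝓞 L'), c • w ≠ w →
      Valued.v (((Literature.NumberTheory.GaloisRepresentations.principalIdele L' (k * k'⁻¹) : ideleGroup L') :
        AdeleRing (𝓞 L') L').2 w) = 1 := by
    intro w hw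
    have hw₁ : w ≠ w'.1 := fun h' => hw (by rw [h', hw'])
    have hw₂ : c⁻¹ • w ≠ w'.1 := fun h' => hw₁ (by rw [← hw', ← h', smul_inv_smul])
    rw [hquot, ideleGroup_val_snd_mul, ideleGroup_val_inv_snd, map_mul, map_inv₀, hy w hw₁,
      IdeleHerbrand.snd_smul_apply, valued_galAdicCompletionMap, hy _ hw₂, inv_one, mul_one]
  obtain ⟨n, hn, hkn⟩ := exists_pow_eq_one_of_mem_torus_of_forall_smul_ne c h2 hc hTR hTC htorus hunit
  -- integral of finite order ⇒ killed by `#μ(L′)`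
  obtain ⟨ε, hε⟩ := exists_units_eq_of_mem_unitIdeles (principalIdele_mem_unitIdeles_of_pow_eq_one hn hkn)
  have hεn : ε ^ n = 1 := by
    apply Units.ext
    apply IsFractionRing.injective (𝓞 L') L'
    rw [Units.val_pow_eq_pow_val, map_pow, hε, ← Units.val_pow_eq_pow_val, hkn, Units.val_one, Units.val_one, map_one]
  have htors : ε ∈ Units.torsion L' :=
    (CommGroup.mem_torsion ε).mpr (isOfFinOrder_iff_pow_eq_one.mpr ⟨n, Nat.pos_of_ne_zero hn, hεn⟩)
  have hpow : ε ^ Units.torsionOrder L' = 1 := by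
    have hmem : ε ∈ rootsOfUnity (Units.torsionOrder L') (𝓞 L') := by
      rw [Units.rootsOfUnity_eq_torsion]; exact htors
    exact (mem_rootsOfUnity _ _).mp hmem
  apply Units.ext
  rw [Units.val_pow_eq_pow_val, ← hε, ← map_pow, ← Units.val_pow_eq_pow_val, hpow, Units.val_one, Units.val_one, map_one]

/-! ## §2 The key for an odd member of an abstract archimedean family (probe heads VERBATIM) -/

open scoped Classical in
/-- **(B1) THE KEY OF WEIL'S EXTENSION PRINCIPLE for (U3-χ) — head bytes of record (K2E3-p17 (g10)'s probe d711d29af2f0f708).**  Given the (U3-F) ring datum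
`Φ` (`hΦσ`), `hur′`, `hv′`, `μ` with `μ|_{𝕀_{L⁺}} = ω` (`hμω`), and a family `Φfam n` of archimedean characters with `hodd` (odd members restrict to `ω′_∞` on
`BC((L′⁺ ⊗ ℝ)ˣ)`) and `hshift` (`Φ_{n+2j}(k_∞) = Φ_n(k_∞) ∏_w ι_w(k∕k̄)^{j_w}`): there is an ODD `n` such that `ω′(a) · Φfam n (y_∞) · (μ_v ∘ Φ⁻¹)(blk_{w′} y) = 1`
for every admissible triple `a_{L′} · y = (k)`, `y ∈ 𝕌^{(w′)}`.  PROOF: §1 (finite order of `ζ = k∕k̄`), F2 `key_of_complexConj_eq` (the candidate character at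
`n₀ = 1` kills `ker ζ`), F1 `exists_update_prod_zpow_mul_eq_one` (cyclic correction `j = −s·δ_{w₀}`), `hshift` + `hodd` (the shift `n₀ ↦ n₀ + 2j` multiplies the
candidate by `∏_w ι_w(ζ)^{j_w}` on triples).  The binders `hc`, `hc′`, `hμu` are not used (kept for the interface of record).
[cite: Rogawski1990, §13.8 p. 216] [cite: Weil1956, §1] [cite: Arthur2011Draft, d-p.310] -/
theorem exists_odd_key_of_infCharFamily
    (Φ : UnitaryGroup.LocalRing L v ≃+* UnitaryGroup.LocalRing L' v') (_hc : Continuous Φ) (_hc' : Continuous Φ.symm)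
    (hΦσ : ∀ x, Φ ((conjLocal L (IsCMField.complexConj L) v) x) = (conjLocal L' (IsCMField.complexConj L') v') (Φ x))
    (hur' : ∀ w' : HeightOneSpectrum (𝓞 ↥(maximalRealSubfield L')), w' ≠ v' → ∀ W : UnitaryGroup.PlacesOver L' w', Algebra.IsUnramifiedAt (𝓞 ↥(maximalRealSubfield L')) W.1.asIdeal)
    (hv' : ∀ w' : UnitaryGroup.PlacesOver L' v', IsCMField.complexConj L' • w'.1 = w'.1)
    (μ : HeckeCharacter L) (_hμu : μ.IsUnitary)
    (hμω : ∀ x : Literature.NumberTheory.GaloisRepresentations.ideleGroup ↥(maximalRealSubfield L),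
      μ (AdeleRing.ideleBaseChange (↥(maximalRealSubfield L)) L x) = quadraticHeckeCharCM L x)
    (Φfam : (InfinitePlace L' → ℤ) → ((InfiniteAdeleRing L')ˣ →* ℂˣ))
    (hodd : ∀ n : InfinitePlace L' → ℤ, (∀ w, Odd (n w)) → ∀ a : ideleGroup ↥(maximalRealSubfield L'),
      Φfam n (infPart L' (AdeleRing.ideleBaseChange (↥(maximalRealSubfield L')) L' a)) =
        quadraticHeckeCharCM L' (infiniteIdeles ↥(maximalRealSubfield L') (infPart ↥(maximalRealSubfield L') a)))
    (hshift : ∀ (n j : InfinitePlace L' → ℤ) (k : L'ˣ),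
      ((Φfam (n + 2 • j) (infPart L' (Literature.NumberTheory.GaloisRepresentations.principalIdele L' k)) : ℂˣ) : ℂ) =
        Φfam n (infPart L' (Literature.NumberTheory.GaloisRepresentations.principalIdele L' k)) *
          ∏ w : InfinitePlace L', (w.embedding ((k : L') * ((IsCMField.complexConj L') (k : L'))⁻¹)) ^ (j w)) :
    ∃ n : InfinitePlace L' → ℤ, (∀ w, Odd (n w)) ∧
      ∀ (w' : UnitaryGroup.PlacesOver L' v') (a : ideleGroup ↥(maximalRealSubfield L')) (y : ideleGroup L') (k : L'ˣ),
      y ∈ unitIdelesAway w'.1 →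
      AdeleRing.ideleBaseChange (↥(maximalRealSubfield L')) L' a * y = Literature.NumberTheory.GaloisRepresentations.principalIdele L' k →
      (quadraticHeckeCharCM L' a : ℂ) * ((Φfam n (infPart L' y) : ℂ) *
        ((μ.semilocalComponent L v).comp (Units.map (Φ.symm : UnitaryGroup.LocalRing L' v' →+* UnitaryGroup.LocalRing L v).toMonoidHom))
          ((MulEquiv.piUnits (M := fun w : UnitaryGroup.PlacesOver L' v' => w.1.adicCompletion L')).symm (Pi.mulSingle w' (cpt w'.1 y)))) = 1 := by
  haveI : Algebra.IsQuadraticExtension ↥(maximalRealSubfield L') L' := IsCMField.isQuadraticExtension L'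
  -- notation
  set F := ↥(maximalRealSubfield L') with hFdef
  set c := IsCMField.complexConj L' with hcdef
  set BC := AdeleRing.ideleBaseChange F L' with hBC
  set ω := quadraticHeckeCharCM L' with hω
  set χ : (UnitaryGroup.LocalRing L' v')ˣ →* ℂˣ :=
    (μ.semilocalComponent L v).comp (Units.map (Φ.symm : UnitaryGroup.LocalRing L' v' →+* UnitaryGroup.LocalRing L v).toMonoidHom) with hχdef
  have hχ : IsQuadraticCharExtension (conjLocal L' c v') χ :=
    auxGlobaliseChar_local_isQuadraticCharExtension L v L' v' Φ hΦσ μ hμω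
  -- the single place `w₀ ∣ v′` and an infinite place `w∞`
  obtain ⟨w₀⟩ : Nonempty (UnitaryGroup.PlacesOver L' v') := inferInstance
  have hsub : ∀ w' : UnitaryGroup.PlacesOver L' v', w' = w₀ :=
    UnitaryGroup.PlacesOver.eq_of_smul_eq c (IsCMField.complexConj_ne_one L') w₀ (hv' w₀)
  obtain ⟨winf⟩ : Nonempty (InfinitePlace L') := inferInstance
  -- the reference odd exponent `n₀ = 1`
  set n₀ : InfinitePlace L' → ℤ := fun _ => 1 with hn₀def
  have hn₀ : ∀ w, Odd (n₀ w) := fun _ => odd_one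
  -- the `w₀`-block reading `blk : 𝕀_{L′} →* (L′ ⊗ L′⁺_{v′})ˣ`
  set blk : ideleGroup L' →* (UnitaryGroup.LocalRing L' v')ˣ :=
    (MulEquiv.piUnits (M := fun w : UnitaryGroup.PlacesOver L' v' => w.1.adicCompletion L')).symm.toMonoidHom.comp
      ((MonoidHom.mulSingle (fun w : UnitaryGroup.PlacesOver L' v' => (w.1.adicCompletion L')ˣ) w₀).comp (cpt w₀.1)) with hblkdef
  have hblk : ∀ y, blk y = (MulEquiv.piUnits (M := fun w : UnitaryGroup.PlacesOver L' v' => w.1.adicCompletion L')).symm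
      (Pi.mulSingle w₀ (cpt w₀.1 y)) := fun _ => rfl
  -- (1) THE TRIPLE GROUP
  let P := ideleGroup F × (ideleGroup L' × L'ˣ)
  let G : Subgroup P :=
    { carrier := {p | BC p.1 * p.2.1 = Literature.NumberTheory.GaloisRepresentations.principalIdele L' p.2.2 ∧ p.2.1 ∈ unitIdelesAway w₀.1}
      one_mem' := ⟨by simp, Subgroup.one_mem _⟩
      mul_mem' := fun {p q} hp hq => ⟨by
        change BC (p.1 * q.1) * (p.2.1 * q.2.1) = Literature.NumberTheory.GaloisRepresentations.principalIdele L' (p.2.2 * q.2.2)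
        rw [map_mul, map_mul, mul_mul_mul_comm, hp.1, hq.1], Subgroup.mul_mem _ hp.2 hq.2⟩
      inv_mem' := fun {p} hp => ⟨by
        change BC p.1⁻¹ * p.2.1⁻¹ = Literature.NumberTheory.GaloisRepresentations.principalIdele L' p.2.2⁻¹
        rw [map_inv, map_inv, ← mul_inv, hp.1], Subgroup.inv_mem _ hp.2⟩ }
  have hGmem : ∀ p : P, p ∈ G ↔
      BC p.1 * p.2.1 = Literature.NumberTheory.GaloisRepresentations.principalIdele L' p.2.2 ∧ p.2.1 ∈ unitIdelesAway w₀.1 := fun _ => Iff.rfl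
  -- projections and `ζ(a, y, k) = k / c k`
  set pa : P →* ideleGroup F := MonoidHom.fst _ _ with hpa
  set py : P →* ideleGroup L' := (MonoidHom.fst _ _).comp (MonoidHom.snd (ideleGroup F) _) with hpy
  set pk : P →* L'ˣ := (MonoidHom.snd _ _).comp (MonoidHom.snd (ideleGroup F) _) with hpk
  set cu : L'ˣ →* L'ˣ := Units.map (c : L' →+* L').toMonoidHom with hcu
  set ζ : ↥G →* L'ˣ := ((MonoidHom.id L'ˣ) * cu⁻¹).comp (pk.comp G.subtype) with hζdef
  have hζ : ∀ g : ↥G, ζ g = (g : P).2.2 * (cu (g : P).2.2)⁻¹ := fun _ => rfl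
  -- `ζ^N = 1`, `N = #μ(L′)`
  haveI : NeZero (Units.torsionOrder L') := ⟨Units.torsionOrder_ne_zero L'⟩
  have hζN : ∀ g : ↥G, ζ g ^ Units.torsionOrder L' = 1 := fun g => by
    rw [hζ]
    exact pow_torsionOrder_eq_one_of_triple_unitIdelesAway L' v' w₀ (hv' w₀) ((hGmem g).1 g.2).2 ((hGmem g).1 g.2).1
  -- (2) THE CANDIDATE CHARACTER `Ψ = Ψ_{n₀}` on `G` and its triviality on `ker ζ`
  set Ψ : ↥G →* ℂˣ :=
    (ω.toContinuousMonoidHom.toMonoidHom.comp (pa.comp G.subtype)) *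
      (((Φfam n₀).comp ((infPart L').comp (py.comp G.subtype))) * (χ.comp (blk.comp (py.comp G.subtype)))) with hΨdef
  have hΨ : ∀ g : ↥G, ((Ψ g : ℂˣ) : ℂ) =
      (ω (g : P).1 : ℂ) * ((Φfam n₀ (infPart L' (g : P).2.1) : ℂ) * χ (blk (g : P).2.1)) := fun g => by
    rw [hΨdef, MonoidHom.mul_apply, MonoidHom.mul_apply, Units.val_mul, Units.val_mul]
    rfl
  have hΨker : ∀ g : ↥G, ζ g = 1 → Ψ g = 1 := by
    intro g hg
    have hk : c ((g : P).2.2 : L') = (g : P).2.2 := by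
      rw [hζ, mul_inv_eq_one, eq_comm] at hg
      have h1 := congrArg (fun u : L'ˣ => (u : L')) hg
      simpa [hcu] using h1
    rw [← Units.val_eq_one, hΨ, hblk]
    exact key_of_complexConj_eq L' v' hur' w₀ (hv' w₀) χ hχ (Φfam n₀) (hodd n₀ hn₀) ((hGmem g).1 g.2).2 ((hGmem g).1 g.2).1 hk
  -- (3) CYCLIC CORRECTION
  obtain ⟨s, hs⟩ := exists_update_prod_zpow_mul_eq_one ζ hζN Ψ hΨker (fun w : InfinitePlace L' => w.embedding) winf
  set j : InfinitePlace L' → ℤ := Function.update (0 : InfinitePlace L' → ℤ) winf (-s) with hjdef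
  refine ⟨n₀ + 2 • j, fun w => ?_, fun w' a y k hy h => ?_⟩
  · -- `n₀ + 2 j` is odd
    refine ⟨j w, ?_⟩
    change (1 : ℤ) + (2 : ℕ) • j w = 2 * j w + 1
    rw [nsmul_eq_mul]
    push_cast
    ring
  · -- (4) THE KEY at `n = n₀ + 2 j`
    obtain rfl : w' = w₀ := hsub w'
    set g : ↥G := ⟨(a, y, k), (hGmem (a, y, k)).2 ⟨h, hy⟩⟩ with hgdef
    have hsg := hs g
    -- `ζ g` in `L′`: `k / c k`
    have hζval : ((ζ g : L'ˣ) : L') = (k : L') * (c (k : L'))⁻¹ := by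
      rw [hζ, Units.val_mul, Units.val_inv_eq_inv_val]
      rfl
    -- the shift on `y_∞ = k_∞ / (a_{L′})_∞`
    have hinf : infPart L' y = (infPart L' (BC a))⁻¹ * infPart L' (Literature.NumberTheory.GaloisRepresentations.principalIdele L' k) := by
      rw [eq_inv_mul_iff_mul_eq, ← map_mul, h]
    have hoddn : ∀ n : InfinitePlace L' → ℤ, (∀ w, Odd (n w)) →
        ((Φfam n (infPart L' y) : ℂˣ) : ℂ) = ((ω (infiniteIdeles F (infPart F a)))⁻¹ : ℂˣ) *
          ((Φfam n (infPart L' (Literature.NumberTheory.GaloisRepresentations.principalIdele L' k)) : ℂˣ) : ℂ) := fun n hn => by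
      rw [hinf, map_mul, map_inv, hBC, hodd n hn a, Units.val_mul]
    have hodd' : ∀ w, Odd ((n₀ + 2 • j) w) := fun w =>
      ⟨j w, by change (1 : ℤ) + (2 : ℕ) • j w = 2 * j w + 1; rw [nsmul_eq_mul]; push_cast; ring⟩
    have hΦn : ((Φfam (n₀ + 2 • j) (infPart L' y) : ℂˣ) : ℂ) =
        ((Φfam n₀ (infPart L' y) : ℂˣ) : ℂ) * ∏ w : InfinitePlace L', (w.embedding ((k : L') * (c (k : L'))⁻¹)) ^ (j w) := by
      rw [hoddn _ hodd', hoddn _ hn₀, hshift n₀ j k, mul_assoc]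
    -- assemble with the cyclic correction `(∏_w ι_w(ζ g)^{j w}) · Ψ g = 1`
    rw [hΨ, hζval] at hsg
    change (∏ w : InfinitePlace L', (w.embedding ((k : L') * (c (k : L'))⁻¹)) ^ (j w)) *
      ((ω a : ℂ) * ((Φfam n₀ (infPart L' y) : ℂ) * χ (blk y))) = 1 at hsg
    rw [hΦn, ← hblk]
    linear_combination hsg

open scoped Classical in
/-- **ASSEMBLY — the `hKey`-payer of ★ `auxGlobaliseChar_of_key` from (B1) and the four (B2) family lemmas `hcont hunit hodd hshift` about ONE family** (probe bytes
VERBATIM): `Φ_∞ := Φfam n` for the odd `n` of `exists_odd_key_of_infCharFamily`. [cite: Rogawski1990, §13.8 p. 216] [cite: Weil1956, §1] -/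
theorem exists_infChar_key_of_family
    (Φ : UnitaryGroup.LocalRing L v ≃+* UnitaryGroup.LocalRing L' v') (hc : Continuous Φ) (hc' : Continuous Φ.symm)
    (hΦσ : ∀ x, Φ ((conjLocal L (IsCMField.complexConj L) v) x) = (conjLocal L' (IsCMField.complexConj L') v') (Φ x))
    (hur' : ∀ w' : HeightOneSpectrum (𝓞 ↥(maximalRealSubfield L')), w' ≠ v' → ∀ W : UnitaryGroup.PlacesOver L' w', Algebra.IsUnramifiedAt (𝓞 ↥(maximalRealSubfield L')) W.1.asIdeal)
    (hv' : ∀ w' : UnitaryGroup.PlacesOver L' v', IsCMField.complexConj L' • w'.1 = w'.1)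
    (μ : HeckeCharacter L) (hμu : μ.IsUnitary)
    (hμω : ∀ x : Literature.NumberTheory.GaloisRepresentations.ideleGroup ↥(maximalRealSubfield L),
      μ (AdeleRing.ideleBaseChange (↥(maximalRealSubfield L)) L x) = quadraticHeckeCharCM L x)
    (Φfam : (InfinitePlace L' → ℤ) → ((InfiniteAdeleRing L')ˣ →* ℂˣ))
    (hcont : ∀ n, Continuous (Φfam n)) (hunit : ∀ n z, ‖(Φfam n z : ℂ)‖ = 1)
    (hodd : ∀ n : InfinitePlace L' → ℤ, (∀ w, Odd (n w)) → ∀ a : ideleGroup ↥(maximalRealSubfield L'),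
      Φfam n (infPart L' (AdeleRing.ideleBaseChange (↥(maximalRealSubfield L')) L' a)) =
        quadraticHeckeCharCM L' (infiniteIdeles ↥(maximalRealSubfield L') (infPart ↥(maximalRealSubfield L') a)))
    (hshift : ∀ (n j : InfinitePlace L' → ℤ) (k : L'ˣ),
      ((Φfam (n + 2 • j) (infPart L' (Literature.NumberTheory.GaloisRepresentations.principalIdele L' k)) : ℂˣ) : ℂ) =
        Φfam n (infPart L' (Literature.NumberTheory.GaloisRepresentations.principalIdele L' k)) *
          ∏ w : InfinitePlace L', (w.embedding ((k : L') * ((IsCMField.complexConj L') (k : L'))⁻¹)) ^ (j w)) :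
    ∃ Φinf : (InfiniteAdeleRing L')ˣ →* ℂˣ, Continuous Φinf ∧ (∀ z, ‖(Φinf z : ℂ)‖ = 1) ∧
      ∀ (w' : UnitaryGroup.PlacesOver L' v') (a : ideleGroup ↥(maximalRealSubfield L')) (y : ideleGroup L') (k : L'ˣ),
      y ∈ unitIdelesAway w'.1 →
      AdeleRing.ideleBaseChange (↥(maximalRealSubfield L')) L' a * y = Literature.NumberTheory.GaloisRepresentations.principalIdele L' k →
      (quadraticHeckeCharCM L' a : ℂ) * ((Φinf (infPart L' y) : ℂ) *
        ((μ.semilocalComponent L v).comp (Units.map (Φ.symm : UnitaryGroup.LocalRing L' v' →+* UnitaryGroup.LocalRing L v).toMonoidHom))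
          ((MulEquiv.piUnits (M := fun w : UnitaryGroup.PlacesOver L' v' => w.1.adicCompletion L')).symm (Pi.mulSingle w' (cpt w'.1 y)))) = 1 := by
  obtain ⟨n, -, hkey⟩ := exists_odd_key_of_infCharFamily L v L' v' Φ hc hc' hΦσ hur' hv' μ hμu hμω Φfam hodd hshift
  exact ⟨Φfam n, hcont n, hunit n, hkey⟩

/-! ## §3 The key at the family `Φ_n = circleToUnits ∘ infinityTypeChar L′ n` (★ B2) -/

open scoped Classical in
/-- **THE KEY OF (U3-χ), INSTANTIATED** (dealer 00:19:12Z): at the family `Φ_n := circleToUnits ∘ IdeleClassGroup∕infinityTypeChar L′ n` of ★ B2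
(`R90S3InfCharFamily`: `infCharFamily_continuous ∕ _norm_eq_one ∕ _odd ∕ _shift`), the assembly yields `∃ Φ_∞` continuous, unitary, with the KEY of Weil's
extension principle — exactly the `(Φinf, hΦinfc, hΦinfu, hKey)` input of ★ p863377 `auxGlobaliseChar_of_key` from the (U3-χ) socket's own binders.
[cite: Rogawski1990, §13.8 pp. 212–216] [cite: Weil1956, §1] -/
theorem exists_infChar_key
    (Φ : UnitaryGroup.LocalRing L v ≃+* UnitaryGroup.LocalRing L' v') (hc : Continuous Φ) (hc' : Continuous Φ.symm)
    (hΦσ : ∀ x, Φ ((conjLocal L (IsCMField.complexConj L) v) x) = (conjLocal L' (IsCMField.complexConj L') v') (Φ x))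
    (hur' : ∀ w' : HeightOneSpectrum (𝓞 ↥(maximalRealSubfield L')), w' ≠ v' → ∀ W : UnitaryGroup.PlacesOver L' w', Algebra.IsUnramifiedAt (𝓞 ↥(maximalRealSubfield L')) W.1.asIdeal)
    (hv' : ∀ w' : UnitaryGroup.PlacesOver L' v', IsCMField.complexConj L' • w'.1 = w'.1)
    (μ : HeckeCharacter L) (hμu : μ.IsUnitary)
    (hμω : ∀ x : Literature.NumberTheory.GaloisRepresentations.ideleGroup ↥(maximalRealSubfield L),
      μ (AdeleRing.ideleBaseChange (↥(maximalRealSubfield L)) L x) = quadraticHeckeCharCM L x) :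
    ∃ Φinf : (InfiniteAdeleRing L')ˣ →* ℂˣ, Continuous Φinf ∧ (∀ z, ‖(Φinf z : ℂ)‖ = 1) ∧
      ∀ (w' : UnitaryGroup.PlacesOver L' v') (a : ideleGroup ↥(maximalRealSubfield L')) (y : ideleGroup L') (k : L'ˣ),
      y ∈ unitIdelesAway w'.1 →
      AdeleRing.ideleBaseChange (↥(maximalRealSubfield L')) L' a * y = Literature.NumberTheory.GaloisRepresentations.principalIdele L' k →
      (quadraticHeckeCharCM L' a : ℂ) * ((Φinf (infPart L' y) : ℂ) *
        ((μ.semilocalComponent L v).comp (Units.map (Φ.symm : UnitaryGroup.LocalRing L' v' →+* UnitaryGroup.LocalRing L v).toMonoidHom))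
          ((MulEquiv.piUnits (M := fun w : UnitaryGroup.PlacesOver L' v' => w.1.adicCompletion L')).symm (Pi.mulSingle w' (cpt w'.1 y)))) = 1 :=
  exists_infChar_key_of_family L v L' v' Φ hc hc' hΦσ hur' hv' μ hμu hμω
    (fun n => (circleToUnits : Circle →ₜ* ℂˣ).toMonoidHom.comp (infinityTypeChar L' n))
    (infCharFamily_continuous L') (infCharFamily_norm_eq_one L') (infCharFamily_odd L') (infCharFamily_shift L')

open scoped Classical in
/-- PLUG SHAPE of record (G ED. n, S3 pen): the (U3-χ) socket's conclusion from `exists_infChar_key` + ★ `auxGlobaliseChar_of_key`, at the socket's binders. -/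
example
    (Φ : UnitaryGroup.LocalRing L v ≃+* UnitaryGroup.LocalRing L' v') (hc : Continuous Φ) (hc' : Continuous Φ.symm)
    (hΦσ : ∀ x, Φ ((conjLocal L (IsCMField.complexConj L) v) x) = (conjLocal L' (IsCMField.complexConj L') v') (Φ x))
    (hur' : ∀ w' : HeightOneSpectrum (𝓞 ↥(maximalRealSubfield L')), w' ≠ v' → ∀ W : UnitaryGroup.PlacesOver L' w', Algebra.IsUnramifiedAt (𝓞 ↥(maximalRealSubfield L')) W.1.asIdeal)
    (hv' : ∀ w' : UnitaryGroup.PlacesOver L' v', IsCMField.complexConj L' • w'.1 = w'.1)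
    (μ : HeckeCharacter L) (hμu : μ.IsUnitary)
    (hμω : ∀ x : Literature.NumberTheory.GaloisRepresentations.ideleGroup ↥(maximalRealSubfield L),
      μ (AdeleRing.ideleBaseChange (↥(maximalRealSubfield L)) L x) = quadraticHeckeCharCM L x) :
    ∃ μ' : HeckeCharacter L',
      μ'.IsUnitary ∧
      (∀ x : Literature.NumberTheory.GaloisRepresentations.ideleGroup ↥(maximalRealSubfield L'),
        μ' (AdeleRing.ideleBaseChange (↥(maximalRealSubfield L')) L' x) = quadraticHeckeCharCM L' x) ∧
      (∀ u : (UnitaryGroup.LocalRing L v)ˣ,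
        μ'.semilocalComponent L' v' (Units.map (Φ : UnitaryGroup.LocalRing L v →+* UnitaryGroup.LocalRing L' v').toMonoidHom u) = μ.semilocalComponent L v u) ∧
      (∀ w' : HeightOneSpectrum (𝓞 ↥(maximalRealSubfield L')), w' ≠ v' → ∀ W : UnitaryGroup.PlacesOver L' w', μ'.IsUnramifiedAt W.1) := by
  obtain ⟨Φinf, hΦc, hΦu, hK⟩ := exists_infChar_key L v L' v' Φ hc hc' hΦσ hur' hv' μ hμu hμω
  exact auxGlobaliseChar_of_key L v L' v' Φ hc' hv' μ hμu Φinf hΦc hΦu hK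

end Summit.HodgeConjecture.HodgeConjecture.R90.S3

end
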